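import Summits.ValiantsHypothesis.ValiantsHypothesis.Theorems.LacunarySymmetroidMatrixDescartesCensusLP34Kit

/-!
# `MatrixDescartes` census — DOOR A at `(3,4)`: LP34 replay KIT, part B (single-letter assembly)

HONEST FRAMING.  Object-search cell `pub-symmetroid`; beside the OPEN typed statement `DoorA34 = PosRootLawAt 3 4 18`
(route item `Theses.LacunarySymmetroid.DoorA34`, stmt-ValiantsHypothesis-19980), asserted nowhere.  Companion of `…CensusLP34Kit`:
on supports where engine-2's LP34 table kills only SOME definite-letter positions (e.g. `(0,2,8,15)`: letters 0, 1, 2; `(0,1,4,N)`: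
letters 0, 1 — LP34-CERT.md §1) the chamber row is stated letter by letter.  `posRoots_le_18_of_not_posDef_letter`: if on the
support `d` the letter in position `l` of a real symmetric `3 × 3` pencil with `≥ 19` distinct positive det-roots is never POSITIVE
definite, then every real symmetric pencil on `d` whose letter `l` is definite (positive or negative — sign flip
`Census.posRoots_pencil_neg_three`) has at most `18` distinct positive det-roots.  Nothing here on the all-indefinite residue of
`DoorA34`, on `ζ_sym(3,4)`, on `MatrixDescartes` (stmt-ValiantsHypothesis-18050) or `VP ≠ VNP`.

[folklore] Bookkeeping; elementary.
-/

-- `Summit.ValiantsHypothesis.ValiantsHypothesis.…` repeats a component by the D-0017 layout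
-- (single-conjunct summit), which the `dupNamespace` linter flags; the name is mandated.
set_option linter.dupNamespace false

namespace Summit.ValiantsHypothesis.ValiantsHypothesis.Theorems.LacunarySymmetroidMatrixDescartes.Census

open Polynomial Matrix Finset
open scoped BigOperators Polynomial Matrix

/-- **Single-letter assembly.**  If on the support `d` the letter `S l` of a real symmetric `3 × 3` pencil with `≥ 19` distinct
positive det-roots is never positive definite, then every real symmetric pencil on `d` whose letter `S l` is positive OR negative
definite has at most `18` distinct positive det-roots (the negative case is the positive case of the flipped pencil `−S`). [folklore] -/
theorem posRoots_le_18_of_not_posDef_letter (d : Fin 4 → ℕ) (l : Fin 4)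
    (h : ∀ (S : Fin 4 → Matrix (Fin 3) (Fin 3) ℝ), (∀ l, (S l).IsSymm) →
      19 ≤ ((∑ l, ((X : ℝ[X]) ^ d l) • (S l).map C).det.roots.toFinset.filter (fun t => 0 < t)).card →
      ¬ (S l).PosDef)
    (S : Fin 4 → Matrix (Fin 3) (Fin 3) ℝ) (hS : ∀ l, (S l).IsSymm) (hdef : (S l).PosDef ∨ (-S l).PosDef) :
    ((∑ l, ((X : ℝ[X]) ^ d l) • (S l).map C).det.roots.toFinset.filter (fun t => 0 < t)).card ≤ 18 := by
  by_contra hlt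
  have h19 : 19 ≤ ((∑ l, ((X : ℝ[X]) ^ d l) • (S l).map C).det.roots.toFinset.filter (fun t => 0 < t)).card := by omega
  rcases hdef with hl | hl
  · exact h S hS h19 hl
  · refine h (fun l => -S l) (fun l => (hS l).neg) ?_ hl
    rw [posRoots_pencil_neg_three]
    exact h19

/-- The all-letters form as a corollary of the single-letter form (same content as `posRoots_le_18_of_forall_not_posDef`, stated
so that a per-support file can mix dead and alive positions). [folklore] -/
theorem posRoots_le_18_of_not_posDef_letters (d : Fin 4 → ℕ) (dead : Finset (Fin 4))
    (h : ∀ l ∈ dead, ∀ (S : Fin 4 → Matrix (Fin 3) (Fin 3) ℝ), (∀ l, (S l).IsSymm) →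
      19 ≤ ((∑ l, ((X : ℝ[X]) ^ d l) • (S l).map C).det.roots.toFinset.filter (fun t => 0 < t)).card →
      ¬ (S l).PosDef)
    (S : Fin 4 → Matrix (Fin 3) (Fin 3) ℝ) (hS : ∀ l, (S l).IsSymm) (hdef : ∃ l ∈ dead, (S l).PosDef ∨ (-S l).PosDef) :
    ((∑ l, ((X : ℝ[X]) ^ d l) • (S l).map C).det.roots.toFinset.filter (fun t => 0 < t)).card ≤ 18 := by
  obtain ⟨l, hl, hdl⟩ := hdef
  exact posRoots_le_18_of_not_posDef_letter d l (h l hl) S hS hdl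

end Summit.ValiantsHypothesis.ValiantsHypothesis.Theorems.LacunarySymmetroidMatrixDescartes.Census
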